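import Mathlib
import Literature.MathematicalPhysics.QuantumFieldTheory.Balaban1983to89.Setup

/-!
# Beta / CutoffVariant316 — BINDER-OWNERS row D4, co-owner road P2′: the BUDGET FUNCTION of the ω-form remainder bound and
# its elementary real analysis with EXPLICIT thresholds (leaf C + the «engines for the numerical constants» half of the
# assigned technique; β sub-cell, unit `b2b-balaban-beta-d4-p2`, generation 1; NODE C / T.2 of
# `HOME/beta/skeletons/D4-b2b-balaban-beta-d4-p2.md`)

HONEST FRAMING (page 1 of everything the β sub-cell writes): discharging `BetaPertH` makes Bałaban's UV stability
UNCONDITIONAL — a real constructive-QFT result; it is NOT the continuum limit and NOT the Clay problem.  HONEST DEPENDENCY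
(cell reorg 2026-08-19, verbatim): «continuum YM on T⁴ ⇐ BetaPertH ∧ nine spine estimates (0/9 proved); BetaPertH ⇐ (D1) ∧
(D4) ∧ CAP+tail; G-an2-4 gates asym, D1 and NE2/3/4.»  THIS MODULE INSTANTIATES NO BINDER AND ASSERTS NOTHING ABOUT
BAŁABAN'S β-FUNCTIONS.  It is elementary real analysis about ONE explicit function of the coupling, every declaration a
definition or a theorem proved from Mathlib and the UNMODIFIED tree definition `p0Profile` ([Balaban1988Convergent] (2.4)
p. 255 «ε_j = g_jA₀(log g_j^{−2})^{p₀} = g_jp₀(g_j)», typed by the foundations cell in `…Balaban1983to89.Setup`).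

ABSOLUTE RULE (cell charter, verbatim): "No internally-minted statement may enter as a cited fact. Every hypothesis is
either kernel-proved in this package or a verbatim quotation of a PUBLISHED theorem with page reference. The manuscript(s)
under audit are NOT citable for their own disputed steps — they are the thing under adjudication; programme-internal
(2001/route/tribunal) claims are never citable."  Nothing is cited as a fact here.

## The object

Road P2′ (skeleton §2, (J7)) bounds the β¹-generating effective-action terms of the construction variant «[I]/[II]'s
small-field step with [III]'s fluctuation cut-off (3.16) p. 268» by an (I.1.18)-type bound whose ACTIVITY BUDGET depends on
the last coupling g = g_k:
    `budget(g) = g·(c_I·r(g)³ + c_E·r(g)) + c_χ·exp(−λ·r(g)²)`,   `r(g) = A₁(log g⁻²)^{p₀}` = `p0Profile A₁ p₀ g`,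
where `r(g_k) = δ_k/g_k` is [III]'s cut-off radius on the unit-covariance fluctuation variable ((3.16) p. 268 with (3.4)
p. 265 «δ_k = g_kA₁/A₀p₀(g_k)»; cell GAPS G-adv6-14a, C-adv5-22 (a)), `g·c_I·r³` is the sup of the CUBIC insertion of
(3.31) p. 273 on the r-box ([III] p. 278 l. 16 «B₀ replaced by O(p₀³(g_k)) … multiplication by g_k»), `g·c_E·r` the
curly-bracket insertion (one field power times a first derivative of the old terms at [I]'s ABSOLUTE radius α₀), and
`c_χ·exp(−λr²)` the Gaussian tail of the cut-off term of (3.32)/(3.37) (GAPS C-adv5-22 (c): λ = λ₀/4).  The constants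
c_I, c_E, c_χ, λ, A₁ are products of letters chosen BEFORE γ in the printed order; this file treats them as non-negative
reals and proves, with EXPLICIT closed-form thresholds (no `∃`-only constants):
* §2 the one inequality behind everything: `x ↦ e^{−x/2}x^m` is ANTItone on `[2m, ∞)` (`exp_mul_pow_antitone`), by
  `1 + t ≤ e^t` only — no calculus;
* §3 `budget` is non-negative on `]0,1]` and MONOTONE on `]0, e^{−3p₀}]` (`budget_monotoneOn`) — the hypothesis `hmono` of
  `RoadP2Chain.ChainVar.remainderConst` / `endpointExistence_of_chainVar`, with the explicit box `γ ≤ e^{−3p₀}`;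
* §4 `budget → 0` at `0⁺` (`tendsto_budget`) — the hypothesis `hA` of `RoadP2Chain.exists_threshold` (so (hr) holds by
  shrinking γ: NO N3-type restriction);
* §5 leaf C.1 (cut-off compatibility with [II] (1.21) p. 7 «e^{16κ₁}g_k|B| < 4B₀C₁e^{16κ₁}ε₁»): `g·r(g) ≤ A₁·4^{p₀}·p₀!·√g`,
  hence `g·r(g) ≤ η` for `g ≤ γ_c(η) := (η/(A₁4^{p₀}p₀!))²` (`mul_p0Profile_le_of_le_gammaC`);
* §6 leaf C.2 (the variant of [II]'s restriction R16 p. 18 «(1/20)γ₂ε₁²/g_k² ≥ … ≥ 4κ», repaired constant 18 =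
  `B13.Consts.R16repaired`): `18κ ≤ (1/20)γ₂r(g)²` for `g ≤ γ_R := exp(−½·max{1, (360κ/(γ₂A₁²))^{1/(2p₀)}})` (`R16_variant`);
* §7 leaf T.2 (ii) (C-adv5-22's «smaller than any power of g_k», made quantitative): `exp(−λr(g)²) ≤ g^m` for
  `g ≤ γ_T := exp(−½·max{1, (m/(2λA₁²))^{1/(2p₀−1)}})` (`cutoffTail_le_pow`).
Second engine (interval arithmetic, mpmath, 50 digits) for the closed forms of §5–§7 at sample letters: cell file
`HOME/b2b-balaban-beta-d4-p2/NUMERICS-C.md` (agreement to the last printed digit; the kernel lemmas are engine 1).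

NOT CLAIMED: the VALUES of c_I, c_E, c_χ, λ for Bałaban's construction (closed formulas in [II]'s located letters, numbers
nobody has — same status as the row owner's K_rem,L); anything of `BetaPertH`; NOT continuum, NOT Clay.
-/

namespace Summit.QuantumFields.BalabanUV.Beta.CutoffVariant316

open Literature.MathematicalPhysics.QuantumFieldTheory.Balaban1983to89
open Real Filter Topology Set

noncomputable section

/-! ## §1 The logarithmic variable `x = log g⁻²` and the cut-off radius `r(g) = A₁x^{p₀}` -/

/-- The logarithmic coupling variable `x(g) := log (g²)⁻¹` (= `−2 log g`); [III] writes `log g_j^{−2}`. -/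
def xOf (g : ℝ) : ℝ := Real.log (g ^ 2)⁻¹

/-- `x(g) = −2 log g` (for every real g, by Mathlib's conventions for `log`). -/
theorem xOf_eq (g : ℝ) : xOf g = -2 * Real.log g := by
  unfold xOf; rw [Real.log_inv, Real.log_pow]; push_cast; ring

/-- For `g > 0`: `exp(−x(g)/2) = g`. -/
theorem exp_neg_half_xOf {g : ℝ} (hg : 0 < g) : Real.exp (-(xOf g) / 2) = g := by
  rw [xOf_eq, show -(-2 * Real.log g) / 2 = Real.log g by ring, Real.exp_log hg]

/-- For `g > 0`: `exp(−x(g)/4) = √g`. -/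
theorem exp_neg_quarter_xOf {g : ℝ} (hg : 0 < g) : Real.exp (-(xOf g) / 4) = Real.sqrt g := by
  have h2 : Real.exp (-(xOf g) / 4) * Real.exp (-(xOf g) / 4) = g := by
    rw [← Real.exp_add, show -(xOf g) / 4 + -(xOf g) / 4 = -(xOf g) / 2 by ring, exp_neg_half_xOf hg]
  rw [eq_comm, Real.sqrt_eq_iff_mul_self_eq_of_pos (Real.exp_pos _)]
  exact h2

/-- `x` is antitone in `g` on `g > 0`. -/
theorem xOf_antitone {g g' : ℝ} (hg : 0 < g) (hgg' : g ≤ g') : xOf g' ≤ xOf g := by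
  rw [xOf_eq, xOf_eq]
  have := Real.log_le_log hg hgg'
  linarith

/-- `x(g) ≥ 0` for `0 < g ≤ 1`. -/
theorem xOf_nonneg {g : ℝ} (hg : 0 < g) (hg1 : g ≤ 1) : 0 ≤ xOf g := by
  rw [xOf_eq]; have := Real.log_nonpos hg.le hg1; linarith

/-- `g ≤ exp(−X/2)` forces `x(g) ≥ X` (for `g > 0`). -/
theorem le_xOf_of_le_exp {g X : ℝ} (hg : 0 < g) (h : g ≤ Real.exp (-X / 2)) : X ≤ xOf g := by
  rw [xOf_eq]
  have := Real.log_le_log hg h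
  rw [Real.log_exp] at this
  linarith

/-- `x(g) → +∞` as `g → 0⁺`. -/
theorem tendsto_xOf : Tendsto xOf (𝓝[>] (0 : ℝ)) atTop := by
  have h : Tendsto (fun g : ℝ => -2 * Real.log g) (𝓝[>] (0 : ℝ)) atTop :=
    Real.tendsto_log_nhdsGT_zero.const_mul_atBot_of_neg (by norm_num)
  exact h.congr fun g => (xOf_eq g).symm

/-- The cut-off radius `r(g) = A₁(log g⁻²)^{p₀}` IS the tree's profile `p0Profile A₁ p₀ g` = `A₁·x(g)^{p₀}`. -/
theorem p0Profile_eq_xOf (A₁ : ℝ) (p₀ : ℕ) (g : ℝ) : p0Profile A₁ p₀ g = A₁ * xOf g ^ p₀ := rfl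

/-! ## §2 The one inequality: `e^{−x/2}x^m` is antitone on `[2m, ∞)` -/

/-- **Antitonicity of `x ↦ e^{−x/2}·x^m` beyond `x = 2m`**, from `1 + t ≤ e^t` alone: for `2m ≤ x ≤ y`,
`(y/x)^m = (1 + (y−x)/x)^m ≤ e^{m(y−x)/x} ≤ e^{(y−x)/2}`. -/
theorem exp_mul_pow_antitone (m : ℕ) {x y : ℝ} (hx : 2 * (m : ℝ) ≤ x) (hxpos : 0 < x) (hxy : x ≤ y) :
    Real.exp (-y / 2) * y ^ m ≤ Real.exp (-x / 2) * x ^ m := by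
  have hy : 0 < y := lt_of_lt_of_le hxpos hxy
  -- (y/x)^m ≤ exp((y−x)/2)
  have h1 : y / x ≤ Real.exp ((y - x) / x) := by
    have := Real.add_one_le_exp ((y - x) / x)
    have e : (y - x) / x + 1 = y / x := by field_simp; ring
    linarith [e ▸ this]
  have h2 : (y / x) ^ m ≤ Real.exp ((y - x) / 2) := by
    calc (y / x) ^ m ≤ (Real.exp ((y - x) / x)) ^ m :=
          pow_le_pow_left₀ (by positivity) h1 m
      _ = Real.exp ((m : ℝ) * ((y - x) / x)) := by rw [← Real.exp_nat_mul]
      _ ≤ Real.exp ((y - x) / 2) := by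
          apply Real.exp_le_exp.2
          rw [show (m : ℝ) * ((y - x) / x) = (y - x) * ((m : ℝ) / x) by ring]
          have hmx : (m : ℝ) / x ≤ 1 / 2 := by
            rw [div_le_iff₀ hxpos]; linarith
          have hyx : 0 ≤ y - x := by linarith
          calc (y - x) * ((m : ℝ) / x) ≤ (y - x) * (1 / 2) := mul_le_mul_of_nonneg_left hmx hyx
            _ = (y - x) / 2 := by ring
  -- y^m = x^m (y/x)^m
  have h3 : y ^ m = x ^ m * (y / x) ^ m := by
    rw [← mul_pow]; congr 1; field_simp
  rw [h3]
  have h4 : Real.exp (-y / 2) * Real.exp ((y - x) / 2) = Real.exp (-x / 2) := by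
    rw [← Real.exp_add]; congr 1; ring
  calc Real.exp (-y / 2) * (x ^ m * (y / x) ^ m)
      = x ^ m * (Real.exp (-y / 2) * (y / x) ^ m) := by ring
    _ ≤ x ^ m * (Real.exp (-y / 2) * Real.exp ((y - x) / 2)) := by
        apply mul_le_mul_of_nonneg_left _ (by positivity)
        exact mul_le_mul_of_nonneg_left h2 (Real.exp_pos _).le
    _ = Real.exp (-x / 2) * x ^ m := by rw [h4]; ring

/-- In the coupling variable: for `0 < g ≤ g' ≤ e^{−m}` one has `g·x(g)^m ≤ g'·x(g')^m` (monotone in g). -/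
theorem mul_xOf_pow_mono (m : ℕ) {g g' : ℝ} (hg : 0 < g) (hgg' : g ≤ g') (hg' : g' ≤ Real.exp (-(m : ℝ))) :
    g * xOf g ^ m ≤ g' * xOf g' ^ m := by
  have hg'pos : 0 < g' := lt_of_lt_of_le hg hgg'
  have hx' : 2 * (m : ℝ) ≤ xOf g' :=
    le_xOf_of_le_exp hg'pos (by rw [show -(2 * (m : ℝ)) / 2 = -(m : ℝ) by ring]; exact hg')
  have hxx : xOf g' ≤ xOf g := xOf_antitone hg hgg'
  rcases Nat.eq_zero_or_pos m with hm | hm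
  · subst hm; simpa using hgg'
  have hx'pos : 0 < xOf g' := lt_of_lt_of_le (by positivity) hx'
  have key := exp_mul_pow_antitone m hx' hx'pos hxx
  rw [exp_neg_half_xOf hg, exp_neg_half_xOf hg'pos] at key
  exact key

/-! ## §3 The budget function, its sign and monotonicity -/

/-- **THE ROAD-P2′ ACTIVITY BUDGET** `budget(g) = g·(c_I·r³ + c_E·r) + c_χ·exp(−λ·r²)`, `r = p0Profile A₁ p₀ g`. -/
def budget (cI cE cχ lam A₁ : ℝ) (p₀ : ℕ) (g : ℝ) : ℝ :=
  g * (cI * p0Profile A₁ p₀ g ^ 3 + cE * p0Profile A₁ p₀ g) + cχ * Real.exp (-lam * p0Profile A₁ p₀ g ^ 2)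

/-- The cut-off radius is non-negative on `]0,1]` for `A₁ ≥ 0`. -/
theorem p0Profile_nonneg {A₁ : ℝ} (hA₁ : 0 ≤ A₁) (p₀ : ℕ) {g : ℝ} (hg : 0 < g) (hg1 : g ≤ 1) :
    0 ≤ p0Profile A₁ p₀ g := by
  rw [p0Profile_eq_xOf]; exact mul_nonneg hA₁ (pow_nonneg (xOf_nonneg hg hg1) _)

/-- The budget is non-negative on `]0,1]` for non-negative constants. -/
theorem budget_nonneg {cI cE cχ lam A₁ : ℝ} (hcI : 0 ≤ cI) (hcE : 0 ≤ cE) (hcχ : 0 ≤ cχ) (hA₁ : 0 ≤ A₁)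
    (p₀ : ℕ) {g : ℝ} (hg : 0 < g) (hg1 : g ≤ 1) : 0 ≤ budget cI cE cχ lam A₁ p₀ g := by
  unfold budget
  have hr := p0Profile_nonneg hA₁ p₀ hg hg1
  positivity

/-- `exp(−3p₀) ≤ exp(−p₀) ≤ 1`: the monotonicity box is inside `]0,1]`. -/
theorem exp_neg_three_le (p₀ : ℕ) : Real.exp (-(3 * (p₀ : ℝ))) ≤ Real.exp (-(p₀ : ℝ)) ∧ Real.exp (-(p₀ : ℝ)) ≤ 1 := by
  constructor
  · apply Real.exp_le_exp.2; have : (0 : ℝ) ≤ p₀ := Nat.cast_nonneg _; linarith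
  · rw [Real.exp_le_one_iff]; have : (0 : ℝ) ≤ p₀ := Nat.cast_nonneg _; linarith

/-- **MONOTONICITY OF THE BUDGET on `]0, e^{−3p₀}]`** (non-negative constants, `A₁ ≥ 0`, `λ ≥ 0`): the supremum of
`budget(g_k)` over a history box `]0,γ]^{k+1}` with `γ ≤ e^{−3p₀}` is `budget(γ)` — hypothesis `hmono` of
`RoadP2Chain.ChainVar.remainderConst`. -/
theorem budget_monotoneOn {cI cE cχ lam A₁ : ℝ} (hcI : 0 ≤ cI) (hcE : 0 ≤ cE) (hcχ : 0 ≤ cχ) (hlam : 0 ≤ lam)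
    (hA₁ : 0 ≤ A₁) (p₀ : ℕ) :
    MonotoneOn (budget cI cE cχ lam A₁ p₀) (Ioc 0 (Real.exp (-(3 * (p₀ : ℝ))))) := by
  intro g hg g' hg' hgg'
  have hgpos : 0 < g := hg.1
  have hg'pos : 0 < g' := hg'.1
  obtain ⟨h31, h11⟩ := exp_neg_three_le p₀
  have hg'3 : g' ≤ Real.exp (-((3 * p₀ : ℕ) : ℝ)) := by push_cast; exact hg'.2
  have hg'1 : g' ≤ Real.exp (-((p₀ : ℕ) : ℝ)) := hg'.2.trans h31
  unfold budget
  rw [p0Profile_eq_xOf, p0Profile_eq_xOf]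
  -- the three pieces separately
  have hcube : g * xOf g ^ (3 * p₀) ≤ g' * xOf g' ^ (3 * p₀) := mul_xOf_pow_mono (3 * p₀) hgpos hgg' hg'3
  have hlin : g * xOf g ^ p₀ ≤ g' * xOf g' ^ p₀ := mul_xOf_pow_mono p₀ hgpos hgg' hg'1
  have hxx : xOf g' ≤ xOf g := xOf_antitone hgpos hgg'
  have hx'0 : 0 ≤ xOf g' := xOf_nonneg hg'pos (hg'.2.trans (h31.trans h11))
  have htail : Real.exp (-lam * (A₁ * xOf g ^ p₀) ^ 2) ≤ Real.exp (-lam * (A₁ * xOf g' ^ p₀) ^ 2) := by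
    apply Real.exp_le_exp.2
    have : (A₁ * xOf g' ^ p₀) ^ 2 ≤ (A₁ * xOf g ^ p₀) ^ 2 := by
      apply pow_le_pow_left₀ (mul_nonneg hA₁ (pow_nonneg hx'0 _))
      exact mul_le_mul_of_nonneg_left (pow_le_pow_left₀ hx'0 hxx _) hA₁
    nlinarith
  have e1 : ∀ t : ℝ, t * (cI * (A₁ * xOf t ^ p₀) ^ 3 + cE * (A₁ * xOf t ^ p₀)) =
      cI * A₁ ^ 3 * (t * xOf t ^ (3 * p₀)) + cE * A₁ * (t * xOf t ^ p₀) := by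
    intro t; ring
  rw [e1, e1]
  have hA3 : 0 ≤ cI * A₁ ^ 3 := mul_nonneg hcI (pow_nonneg hA₁ 3)
  have hA1 : 0 ≤ cE * A₁ := mul_nonneg hcE hA₁
  gcongr

/-! ## §4 The budget tends to 0 at 0⁺ -/

/-- `e^{−x/2}x^m → 0` as `x → +∞`. -/
theorem tendsto_exp_mul_pow (m : ℕ) : Tendsto (fun x : ℝ => Real.exp (-x / 2) * x ^ m) atTop (𝓝 0) := by
  have h := (Real.tendsto_pow_mul_exp_neg_atTop_nhds_zero m).comp
    (tendsto_id.atTop_div_const (by norm_num : (0 : ℝ) < 2))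
  have h2 : Tendsto (fun x : ℝ => (2 : ℝ) ^ m * ((x / 2) ^ m * Real.exp (-(x / 2)))) atTop (𝓝 ((2 : ℝ) ^ m * 0)) :=
    h.const_mul _
  rw [mul_zero] at h2
  refine h2.congr fun x => ?_
  rw [div_pow, show -(x / 2) = -x / 2 by ring]
  field_simp

/-- `g·x(g)^m → 0` as `g → 0⁺`. -/
theorem tendsto_mul_xOf_pow (m : ℕ) : Tendsto (fun g : ℝ => g * xOf g ^ m) (𝓝[>] (0 : ℝ)) (𝓝 0) := by
  have h := (tendsto_exp_mul_pow m).comp tendsto_xOf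
  refine h.congr' ?_
  filter_upwards [self_mem_nhdsWithin] with g hg
  simp only [Function.comp, mem_Ioi] at hg ⊢
  rw [exp_neg_half_xOf hg]

/-- `exp(−λ·r(g)²) → 0` as `g → 0⁺` (λ > 0, A₁ ≠ 0, p₀ ≥ 1). -/
theorem tendsto_cutoffTail {lam A₁ : ℝ} (hlam : 0 < lam) (hA₁ : A₁ ≠ 0) {p₀ : ℕ} (hp₀ : 1 ≤ p₀) :
    Tendsto (fun g : ℝ => Real.exp (-lam * p0Profile A₁ p₀ g ^ 2)) (𝓝[>] (0 : ℝ)) (𝓝 0) := by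
  have hc : 0 < lam * A₁ ^ 2 := mul_pos hlam (by positivity)
  have hp : 2 * p₀ ≠ 0 := by omega
  have h1 : Tendsto (fun x : ℝ => lam * A₁ ^ 2 * x ^ (2 * p₀)) atTop atTop :=
    (tendsto_pow_atTop hp).const_mul_atTop hc
  have h2 := Real.tendsto_exp_neg_atTop_nhds_zero.comp (h1.comp tendsto_xOf)
  refine h2.congr fun g => ?_
  simp only [Function.comp, p0Profile_eq_xOf]
  congr 1; ring

/-- **THE BUDGET TENDS TO 0 AT 0⁺** (λ > 0, A₁ > 0, p₀ ≥ 1; any real c's) — hypothesis `hA` of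
`RoadP2Chain.exists_threshold`: the (hr) threshold is met by shrinking γ. -/
theorem tendsto_budget (cI cE cχ : ℝ) {lam A₁ : ℝ} (hlam : 0 < lam) (hA₁ : 0 < A₁) {p₀ : ℕ} (hp₀ : 1 ≤ p₀) :
    Tendsto (budget cI cE cχ lam A₁ p₀) (𝓝[>] (0 : ℝ)) (𝓝 0) := by
  have h3 := (tendsto_mul_xOf_pow (3 * p₀)).const_mul (cI * A₁ ^ 3)
  have h1 := (tendsto_mul_xOf_pow p₀).const_mul (cE * A₁)
  have ht := (tendsto_cutoffTail hlam hA₁.ne' hp₀).const_mul cχ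
  have hsum := (h3.add h1).add ht
  simp only [mul_zero, add_zero] at hsum
  refine hsum.congr fun g => ?_
  unfold budget; rw [p0Profile_eq_xOf]; ring

/-! ## §5 Leaf C.1 — cut-off compatibility: `g·r(g) ≤ η` below an explicit `γ_c(η)` -/

/-- `x^{p₀} ≤ 4^{p₀}·p₀!·e^{x/4}` for `x ≥ 0` (from `u^n/n! ≤ e^u` at `u = x/4`). -/
theorem pow_le_factorial_exp (p₀ : ℕ) {x : ℝ} (hx : 0 ≤ x) :
    x ^ p₀ ≤ (4 : ℝ) ^ p₀ * (p₀.factorial : ℝ) * Real.exp (x / 4) := by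
  have h := Real.pow_div_factorial_le_exp (x / 4) (by positivity) p₀
  have hf : (0 : ℝ) < p₀.factorial := by exact_mod_cast Nat.factorial_pos p₀
  rw [div_le_iff₀ hf] at h
  calc x ^ p₀ = (4 : ℝ) ^ p₀ * (x / 4) ^ p₀ := by rw [← mul_pow]; congr 1; ring
    _ ≤ (4 : ℝ) ^ p₀ * (Real.exp (x / 4) * p₀.factorial) := by
        exact mul_le_mul_of_nonneg_left h (by positivity)
    _ = (4 : ℝ) ^ p₀ * (p₀.factorial : ℝ) * Real.exp (x / 4) := by ring

/-- **`g·r(g) ≤ A₁·4^{p₀}·p₀!·√g` on `]0,1]`** (A₁ ≥ 0). -/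
theorem mul_p0Profile_le_sqrt {A₁ : ℝ} (hA₁ : 0 ≤ A₁) (p₀ : ℕ) {g : ℝ} (hg : 0 < g) (hg1 : g ≤ 1) :
    g * p0Profile A₁ p₀ g ≤ A₁ * 4 ^ p₀ * (p₀.factorial : ℝ) * Real.sqrt g := by
  rw [p0Profile_eq_xOf]
  have hx := xOf_nonneg hg hg1
  have h1 := pow_le_factorial_exp p₀ hx
  -- g * exp(x/4) = exp(-x/2) * exp(x/4) = exp(-x/4) = √g
  have h2 : g * Real.exp (xOf g / 4) = Real.sqrt g := by
    rw [← exp_neg_quarter_xOf hg]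
    have h3 : Real.exp (-(xOf g) / 2) * Real.exp (xOf g / 4) = Real.exp (-(xOf g) / 4) := by
      rw [← Real.exp_add]; congr 1; ring
    rwa [exp_neg_half_xOf hg] at h3
  calc g * (A₁ * xOf g ^ p₀) = A₁ * (g * xOf g ^ p₀) := by ring
    _ ≤ A₁ * (g * ((4 : ℝ) ^ p₀ * (p₀.factorial : ℝ) * Real.exp (xOf g / 4))) := by
        exact mul_le_mul_of_nonneg_left (mul_le_mul_of_nonneg_left h1 hg.le) hA₁
    _ = A₁ * 4 ^ p₀ * (p₀.factorial : ℝ) * (g * Real.exp (xOf g / 4)) := by ring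
    _ = A₁ * 4 ^ p₀ * (p₀.factorial : ℝ) * Real.sqrt g := by rw [h2]

/-- The explicit compatibility threshold `γ_c(η) := (η / (A₁·4^{p₀}·p₀!))²`. -/
def gammaC (η A₁ : ℝ) (p₀ : ℕ) : ℝ := (η / (A₁ * 4 ^ p₀ * (p₀.factorial : ℝ))) ^ 2

/-- **LEAF C.1 — CUT-OFF COMPATIBILITY WITH AN EXPLICIT THRESHOLD**: for `0 < g ≤ min{1, γ_c(η)}` the product
`g·r(g)` — the size `g_k|B|` of the scaled fluctuation field on [III]'s cut-off box, which is all that [II] (1.21) p. 7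
(«e^{16κ₁}g_k|B| < 4B₀C₁e^{16κ₁}ε₁») and its siblings consume — is at most `η`.  (A₁ > 0, η > 0.) -/
theorem mul_p0Profile_le_of_le_gammaC {A₁ η : ℝ} (hA₁ : 0 < A₁) (hη : 0 < η) (p₀ : ℕ) {g : ℝ} (hg : 0 < g)
    (hg1 : g ≤ 1) (hgc : g ≤ gammaC η A₁ p₀) : g * p0Profile A₁ p₀ g ≤ η := by
  have hK : 0 < A₁ * 4 ^ p₀ * (p₀.factorial : ℝ) := by
    have : (0 : ℝ) < p₀.factorial := by exact_mod_cast Nat.factorial_pos p₀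
    positivity
  have h1 := mul_p0Profile_le_sqrt hA₁.le p₀ hg hg1
  have h2 : Real.sqrt g ≤ η / (A₁ * 4 ^ p₀ * (p₀.factorial : ℝ)) := by
    rw [← Real.sqrt_sq (le_of_lt (div_pos hη hK))]
    exact Real.sqrt_le_sqrt hgc
  calc g * p0Profile A₁ p₀ g ≤ A₁ * 4 ^ p₀ * (p₀.factorial : ℝ) * Real.sqrt g := h1
    _ ≤ A₁ * 4 ^ p₀ * (p₀.factorial : ℝ) * (η / (A₁ * 4 ^ p₀ * (p₀.factorial : ℝ))) :=
        mul_le_mul_of_nonneg_left h2 hK.le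
    _ = η := by field_simp

/-! ## §6 Leaf C.2 — the variant of [II]'s restriction R16, with the SHARP root threshold -/

/-- The explicit R16′ threshold `γ_R := exp(−½·max{1, (360κ/(γ₂A₁²))^{1/(2p₀)}})`. -/
def gammaR (γ₂ A₁ κ : ℝ) (p₀ : ℕ) : ℝ :=
  Real.exp (-(max 1 ((360 * κ / (γ₂ * A₁ ^ 2)) ^ (((2 * p₀ : ℕ) : ℝ)⁻¹))) / 2)

/-- **LEAF C.2 — R16′**: with [III]'s cut-off the large-field factor of [II] (2.22) p. 16 is `exp(−½γ₂r(g_k)²|P|)`, and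
[II] p. 18's «(1/20)γ₂ε₁²/g_k² ≥ … ≥ 4κ» (repaired constant 18: `B13.Consts.R16repaired`) becomes `(1/20)γ₂r(g)² ≥ 18κ`,
which HOLDS for `0 < g ≤ γ_R` — a γ-clause, γ last in the printed order of constants.  (γ₂, A₁ > 0; κ ≥ 0; p₀ ≥ 1.) -/
theorem R16_variant {γ₂ A₁ κ : ℝ} (hγ₂ : 0 < γ₂) (hA₁ : 0 < A₁) (hκ : 0 ≤ κ) {p₀ : ℕ} (hp₀ : 1 ≤ p₀) {g : ℝ}
    (hg : 0 < g) (hgR : g ≤ gammaR γ₂ A₁ κ p₀) : 18 * κ ≤ 1 / 20 * γ₂ * p0Profile A₁ p₀ g ^ 2 := by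
  set c : ℝ := 360 * κ / (γ₂ * A₁ ^ 2) with hcdef
  have hγA : 0 < γ₂ * A₁ ^ 2 := by positivity
  have hc0 : 0 ≤ c := by rw [hcdef]; positivity
  have hX : max 1 (c ^ (((2 * p₀ : ℕ) : ℝ)⁻¹)) ≤ xOf g := le_xOf_of_le_exp hg hgR
  have hρ : c ^ (((2 * p₀ : ℕ) : ℝ)⁻¹) ≤ xOf g := (le_max_right _ _).trans hX
  have hp : 2 * p₀ ≠ 0 := by omega
  have hcx : c ≤ xOf g ^ (2 * p₀) := by
    calc c = (c ^ (((2 * p₀ : ℕ) : ℝ)⁻¹)) ^ (2 * p₀) := (Real.rpow_inv_natCast_pow hc0 hp).symm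
      _ ≤ xOf g ^ (2 * p₀) := pow_le_pow_left₀ (Real.rpow_nonneg hc0 _) hρ _
  rw [p0Profile_eq_xOf, mul_pow, ← pow_mul, mul_comm p₀ 2]
  have h360 : 360 * κ = γ₂ * A₁ ^ 2 * c := by rw [hcdef]; field_simp
  have : γ₂ * A₁ ^ 2 * c ≤ γ₂ * A₁ ^ 2 * xOf g ^ (2 * p₀) := mul_le_mul_of_nonneg_left hcx hγA.le
  nlinarith

/-! ## §7 Leaf T.2 (ii) — the cut-off tail is smaller than any power of the coupling, with the SHARP root threshold -/

/-- The explicit crossover threshold `γ_T(m) := exp(−½·max{1, (m/(2λA₁²))^{1/(2p₀−1)}})`. -/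
def gammaT (lam A₁ : ℝ) (p₀ m : ℕ) : ℝ :=
  Real.exp (-(max 1 (((m : ℝ) / (2 * lam * A₁ ^ 2)) ^ (((2 * p₀ - 1 : ℕ) : ℝ)⁻¹))) / 2)

/-- **LEAF T.2 (ii)**: `exp(−λ·r(g)²) ≤ g^m` for `0 < g ≤ γ_T(m)` (λ, A₁ > 0; p₀ ≥ 1) — GAPS C-adv5-22 (c)'s «smaller than
any power of g_k … once log g_k^{−2} is large» with the «large» made explicit and sharp in the exponent. -/
theorem cutoffTail_le_pow {lam A₁ : ℝ} (hlam : 0 < lam) (hA₁ : 0 < A₁) {p₀ : ℕ} (hp₀ : 1 ≤ p₀) (m : ℕ) {g : ℝ}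
    (hg : 0 < g) (hgT : g ≤ gammaT lam A₁ p₀ m) : Real.exp (-lam * p0Profile A₁ p₀ g ^ 2) ≤ g ^ m := by
  set c : ℝ := (m : ℝ) / (2 * lam * A₁ ^ 2) with hcdef
  have hc2 : 0 < 2 * lam * A₁ ^ 2 := by positivity
  have hc0 : 0 ≤ c := by rw [hcdef]; positivity
  have hX : max 1 (c ^ (((2 * p₀ - 1 : ℕ) : ℝ)⁻¹)) ≤ xOf g := le_xOf_of_le_exp hg hgT
  have hx1 : 1 ≤ xOf g := (le_max_left _ _).trans hX
  have hx0 : 0 ≤ xOf g := by linarith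
  have hρ : c ^ (((2 * p₀ - 1 : ℕ) : ℝ)⁻¹) ≤ xOf g := (le_max_right _ _).trans hX
  have hp : 2 * p₀ - 1 ≠ 0 := by omega
  have hcx : c ≤ xOf g ^ (2 * p₀ - 1) := by
    calc c = (c ^ (((2 * p₀ - 1 : ℕ) : ℝ)⁻¹)) ^ (2 * p₀ - 1) := (Real.rpow_inv_natCast_pow hc0 hp).symm
      _ ≤ xOf g ^ (2 * p₀ - 1) := pow_le_pow_left₀ (Real.rpow_nonneg hc0 _) hρ _
  -- g^m = exp(−m x/2)
  have hgm : g ^ m = Real.exp (-((m : ℝ) * xOf g) / 2) := by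
    rw [← exp_neg_half_xOf hg, ← Real.exp_nat_mul, exp_neg_half_xOf hg]; congr 1; ring
  rw [hgm, p0Profile_eq_xOf]
  apply Real.exp_le_exp.2
  have hsplit : xOf g ^ (2 * p₀) = xOf g * xOf g ^ (2 * p₀ - 1) := by
    rw [← pow_succ']; congr 1; omega
  have hm : (m : ℝ) = 2 * lam * A₁ ^ 2 * c := by rw [hcdef]; field_simp
  rw [mul_pow, ← pow_mul, mul_comm p₀ 2, hsplit, hm]
  have h1 : xOf g * c ≤ xOf g * xOf g ^ (2 * p₀ - 1) := mul_le_mul_of_nonneg_left hcx hx0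
  nlinarith [mul_le_mul_of_nonneg_left h1 hc2.le]

end

end Summit.QuantumFields.BalabanUV.Beta.CutoffVariant316
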